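/-
Copyright (c) 2026 the pub-hodgecm-mathlib formalisation cell (harness21).  Prover seat hodgecm-mathlib-K2E1-p15 (g4), Track B ∕ K2-LIT, h413 = `stmt-HodgeConjecture-24833`, route `HCCMUnconditional`,
R90-TF section S8 «ContSpec-n½», ESTATE T (ruling J-S8-T2): the T HEAD WITH BOTH τ-PORTS PLUGGED IN (S8 dealer R90-CS-plan (g3), S8-R218 2026-09-05T02:03:33Z).
-/
import Summits.HodgeConjecture.HodgeConjecture.Theorems.K2E1ChiEisensteinMeromorphicExportsKFiniteCMThree   -- ★ p864350 (K2E1-p11): T head `…_kfinite_cm_three_of_gauge_letters` (visible letters `hfam`∕`hnc` at `V`)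
import Summits.HodgeConjecture.HodgeConjecture.Theorems.K2E1ChiGaugeSymbolTauCMThree                       -- ★ (K2E2-p12): second port `hfam_gauge_of_scalars_cm_three`∕`hnc_gauge_of_scalars_cm_three` (letter `h12dCτ`), read-backs
import Summits.HodgeConjecture.HodgeConjecture.Theorems.K2E1ChiHeckeArchScalarTauU2                         -- ★ p864413 (this seat): first port `exists_integral_pureTensor_mul_flatSectionU_eq_tau` (pays `h12dCτ`), `exists_line_of_coweightLine`
import HarnessLib

/-!
# S8 ESTATE T — `K2E1ChiEisensteinMeromorphicExportsKFiniteOfPortsCMThree`: THE `χ`-EISENSTEIN EXPORTS WITH BOUND AT A PURE-TYPE K-FINITE BLOCK, BOTH τ-PORTS PLUGGED IN —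
# ★ T head (K2E1-p11) ∘ ★ gauge port (K2E2-p12) ∘ ★ scalar port (this seat): the gauge letters `hfam`∕`hnc` are GONE; visible instead are the block's PURE-TYPE letters
# (`W`-isotypy `hVτ`, the archimedean left law `hVB`, the slice LINE `hline` — or the `z`-free co-weight line) and its level data

Track B ∕ K2-LIT, crux h413 = `stmt-HodgeConjecture-24833`, route of record `HCCMUnconditional`; cell `hodgecm-mathlib`, R90-TF programme, section S8 «ContSpec-n½», ESTATE T (S8-R199∕R204∕R208∕R214;
ruling J-S8-T2, J-S8-T2′).  THEOREMS ONLY (no `def`, no `instance`, no `notation`, no named-fact hypothesis, no `sorry`; default heartbeats); lane `--supports stmt-HodgeConjecture-24833 --as helper`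
(count-neutral).  CLOSES NO SOCKET.  Pure COMPOSITION — no new mathematics.

WHAT THIS FILE DOES ([BernsteinLapid2019, Thm 2.3, §4]; [MoeglinWaldspurger1995, II.1.7, IV.1.8–IV.1.11]; [Knapp1986, VII §1–§2]).  ★ `chiEisenstein_meromorphic_exports_kfinite_cm_three_of_gauge_letters`
(the head of ESTATE T FILE 2) delivers the row-8 `χ`-Eisenstein exports with bound for every member `φ` of a finite-dimensional `K_max`-stable block `V` of continuous bounded `(χ₁, χ₂)`-pair-sections,
modulo row 1's two GAUGE LETTERS `hfam`∕`hnc` AT `V`.  ★ `hfam_gauge_of_scalars_cm_three` ∕ ★ `hnc_gauge_of_scalars_cm_three` (K2E2-p12's port of ★ P1 ∕ ★ 7b-1) pay them from a level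
`U₀ ≤ GL₃(𝒪̂)` (open compact; `V` right-`ι_f(U₀ ∩ G_f)`-invariant, `hVU`), «vanishing on `K_max` ⇒ `0`» (`hVK₀`, here DISCHARGED from `hVχ` by ★ `eq_zero_of_forall_K_eq_zero_of_isChiSectionPair_cm`)
and the PER-`z` SCALAR LETTER `h12dCτ`, which ★ `exists_integral_pureTensor_mul_flatSectionU_eq_tau` (this seat's port of ★ 12d-I ∕ ★ 12d-C) pays from the block's PURE-TYPE data: a
`K_∞`-type `(W, τ)`, the archimedean left law `cB` of the flat sections along `B_∞` (`hVB`), the `W`-ISOTYPY of `V` (`hVτ`: `V` is spanned by its `K_∞`-equivariant copies of `W`) and THE LINE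
`hline z` of the τ-embeddings `W → I_∞(cB z)` — with `U := U₀ ∩ G_f` (`hUK` by ★ `adelicVal_finAdelicToAdelic_mem_of_mem_glFiniteIntegralLevel`, `hVU` re-read through `Subgroup.mem_subgroupOf`).
So §1's head is the T head with NO gauge letter and NO port letter left: its visible binders are the ★ T head's frame and block data, the level data, and the pure-type letters; §2 trades
`hline` for the `z`-FREE CO-WEIGHT LINE on `M_∞ = B_∞ ∩ K_∞` (★ `exists_integral_pureTensor_mul_flatSectionU_eq_tau_of_coweightLine`; the CM datum has `c ≠ 1` fixing every infinite place:
★ `IsCMField.complexConj_ne_one`, ★ `complexConj_smul_infinitePlace`) — the Frobenius image of ★ `R90S8KTypeSliceLineU3`'s multiplicity-one line (the Riesz flip weight vector ↔ co-weight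
functional is the assembler's glue per `v ∣ ∞`).
* §1 **`chiEisenstein_meromorphic_exports_kfinite_of_ports`** — conclusion = ★ T head's, BYTE FOR BYTE.
* §2 **`chiEisenstein_meromorphic_exports_kfinite_of_ports_of_coweightLine`** — the same from the co-weight line.
HONEST LABEL: HC_CM is proved only modulo the 7 printed citations (2 remaining named inputs: hLiu418 = `stmt-HodgeConjecture-24832`, h413 = `stmt-HodgeConjecture-24833`) until rung 0
closes; REL ≠ ★ ≠ BUILT; composition only — the pure-type letters `hVB`∕`hVτ`∕`hline` (resp. the co-weight line) stay VISIBLE and are the T assembler's to pay (★ p863637 `chiSectionSpacePairKType`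
currency for `hVτ`, ★ p864279 for the line); closes no socket; count-neutral.

## References
* [BernsteinLapid2019] J. Bernstein, E. Lapid, *On the meromorphic continuation of Eisenstein series*, J. Amer. Math. Soc. 37 (2024), Thm 2.3, §4 Claim 1, §7.
* [MoeglinWaldspurger1995] C. Mœglin, J.-L. Waldspurger, *Spectral Decomposition and Eisenstein Series* (1995), I.2.17, II.1.7, IV.1.8–IV.1.11.
* [Knapp1986] A. W. Knapp, *Representation Theory of Semisimple Groups* (1986), VII §1–§2.
* [Bump1997] D. Bump, *Automorphic Forms and Representations* (1997), proof of Lemma 2.3.2.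
-/

set_option autoImplicit false
set_option linter.dupNamespace false  -- the mandated namespace repeats the summit's segment (`HodgeConjecture.HodgeConjecture`)

noncomputable section

open MeasureTheory Measure Filter Topology Set NumberField IsDedekindDomain
open scoped NNReal ENNReal ComplexConjugate
open Literature.MeasureTheory.Group Literature.NumberTheory Literature.NumberTheory.Automorphic Literature.NumberTheory.Automorphic.UnitaryGroup AdelicGroupData
open Literature.NumberTheory.Automorphic.Arthur2013.Leaves.TECR
open Literature.NumberTheory.GaloisRepresentations (HeckeCharacter)
open Summit.HodgeConjecture.HodgeConjecture.Cruxes.H413.K2E1BorelEisensteinU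
open Summit.HodgeConjecture.HodgeConjecture.Cruxes.H413.K2E1BLBorelSpacesU2Defs
open Summit.HodgeConjecture.HodgeConjecture.Cruxes.H413.K2E1BLBorelOperatorsU2Defs
open Summit.HodgeConjecture.HodgeConjecture.Cruxes.H413.K2E1CharacterEisensteinU2Defs
open Summit.HodgeConjecture.HodgeConjecture.Cruxes.H413.K2E1BLIotaClosedEmbeddingU3 (iotaBound_cm_three)
open Summit.HodgeConjecture.HodgeConjecture.Cruxes.H413.K2E1CharacterEisensteinU3PairDefs (IsChiSectionPair)
open Summit.HodgeConjecture.HodgeConjecture.Cruxes.H413.K2E1ChiEisensteinMeromorphicExportsKFiniteCMThree (chiEisenstein_meromorphic_exports_kfinite_cm_three_of_gauge_letters)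
open Summit.HodgeConjecture.HodgeConjecture.Cruxes.H413.K2E1ChiGaugeSymbolTauCMThree (hfam_gauge_of_scalars_cm_three hnc_gauge_of_scalars_cm_three eq_zero_of_forall_K_eq_zero_of_isChiSectionPair_cm)
open Summit.HodgeConjecture.HodgeConjecture.Cruxes.H413.K2E1ChiGaugeSymbolTauU3 (adelicVal_finAdelicToAdelic_mem_of_mem_glFiniteIntegralLevel)
open Summit.HodgeConjecture.HodgeConjecture.Cruxes.H413.K2E1ChiHeckeArchScalarTauU2 (exists_integral_pureTensor_mul_flatSectionU_eq_tau exists_line_of_coweightLine)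

namespace Summit.HodgeConjecture.HodgeConjecture.Cruxes.H413.K2E1ChiEisensteinMeromorphicExportsKFiniteOfPortsCMThree

variable (L : Type) [Field L] [NumberField L] [IsCMField L]
  [MeasurableSpace (quasiSplit (↥(maximalRealSubfield L)) L (IsCMField.complexConj L) 3).Adelic] [BorelSpace (quasiSplit (↥(maximalRealSubfield L)) L (IsCMField.complexConj L) 3).Adelic]
  [MeasurableSpace (arch (↥(maximalRealSubfield L)) L (IsCMField.complexConj L) 3 ((StdForm.antidiagonal 3).over L))] [BorelSpace (arch (↥(maximalRealSubfield L)) L (IsCMField.complexConj L) 3 ((StdForm.antidiagonal 3).over L))]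
  [MeasurableSpace (finAdelic (↥(maximalRealSubfield L)) L (IsCMField.complexConj L) 3 ((StdForm.antidiagonal 3).over L))] [BorelSpace (finAdelic (↥(maximalRealSubfield L)) L (IsCMField.complexConj L) 3 ((StdForm.antidiagonal 3).over L))]
  (μ : Measure (quasiSplit (↥(maximalRealSubfield L)) L (IsCMField.complexConj L) 3).automorphicQuotient) [(quasiSplit (↥(maximalRealSubfield L)) L (IsCMField.complexConj L) 3).IsAutomorphicMeasure μ]
  (νG : Measure (quasiSplit (↥(maximalRealSubfield L)) L (IsCMField.complexConj L) 3).Adelic) [νG.IsHaarMeasure] [νG.IsInvInvariant] [SFinite νG]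
  (ν : Measure ↥(adelicUnipotent (↥(maximalRealSubfield L)) L (IsCMField.complexConj L) 3)) [ν.IsHaarMeasure] [ν.IsMulRightInvariant] [ν.IsInvInvariant]
  {𝓕 : Set ↥(adelicUnipotent (↥(maximalRealSubfield L)) L (IsCMField.complexConj L) 3)}
  (h𝓕N : IsFundamentalDomain ↥(rationalUnipotent (↥(maximalRealSubfield L)) L (IsCMField.complexConj L) 3) 𝓕 ν) (h𝓕c : IsCompact (closure 𝓕)) (h𝓕₀ : ν 𝓕 ≠ 0)
  {β : (quasiSplit (↥(maximalRealSubfield L)) L (IsCMField.complexConj L) 3).Adelic → ℝ≥0∞}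
  (hβ : IsCoveringWeight ↥((arithmeticBorel (↥(maximalRealSubfield L)) L (IsCMField.complexConj L) 3).map (quasiSplit (↥(maximalRealSubfield L)) L (IsCMField.complexConj L) 3).arithmeticSubgroup.subtype) β)
  {μZ : Measure (borelQuotient (↥(maximalRealSubfield L)) L (IsCMField.complexConj L) 3)} [SFinite μZ]
  (hμZ : ∀ f : borelQuotient (↥(maximalRealSubfield L)) L (IsCMField.complexConj L) 3 → ℝ≥0∞, Measurable f → ∫⁻ z, f z ∂μZ = ∫⁻ g, β g * f (toBorelQuotient (↥(maximalRealSubfield L)) L (IsCMField.complexConj L) 3 g) ∂νG)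
  -- auxiliary Haar measures on `G_∞` (two-sided) and `G(𝔸_f)` (they only enter the proofs of the ports)
  (μa : Measure (arch (↥(maximalRealSubfield L)) L (IsCMField.complexConj L) 3 ((StdForm.antidiagonal 3).over L))) [μa.IsHaarMeasure] [μa.IsMulRightInvariant]
  (μf : Measure (finAdelic (↥(maximalRealSubfield L)) L (IsCMField.complexConj L) 3 ((StdForm.antidiagonal 3).over L))) [μf.IsHaarMeasure]
  -- the PURE-TYPE K-FINITE BLOCK: finite-dimensional, `K_max`-stable, continuous bounded `(χ₁, χ₂)`-pair-sections, `χ₂` automorphic (★ T head's block binders)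
  {χ₁ : HeckeCharacter L} {χ₂ : ↥(TorusDict.torus (IsCMField.complexConj L)) →ₜ* ℂˣ} (hχ₂ : TorusDict.IsAutomorphic (IsCMField.complexConj L) χ₂)
  (V : Submodule ℂ ((quasiSplit (↥(maximalRealSubfield L)) L (IsCMField.complexConj L) 3).Adelic → ℂ)) [FiniteDimensional ℂ ↥V]
  (hVK : ∀ k ∈ ((standardMaximalCompactGL 3 L).comap (adelicVal (↥(maximalRealSubfield L)) L (IsCMField.complexConj L) 3 ((StdForm.antidiagonal 3).over L)) : Subgroup (quasiSplit (↥(maximalRealSubfield L)) L (IsCMField.complexConj L) 3).Adelic), ∀ ψ ∈ V, (fun x => ψ (x * k)) ∈ V)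
  (hVχ : ∀ ψ ∈ V, IsChiSectionPair χ₁ χ₂ ψ) (hVc : ∀ ψ ∈ V, Continuous ψ) (hVM : ∀ ψ ∈ V, ∃ M : ℝ, ∀ x, ‖ψ x‖ ≤ M)
  -- the LEVEL `U₀ ≤ GL₃(𝒪̂)` (open compact) under which `V` is right-invariant (★ gauge port's binders)
  (U₀ : Subgroup (GL (Fin 3) (FiniteAdeleRing (𝓞 L) L))) (hU₀o : IsOpen (U₀ : Set (GL (Fin 3) (FiniteAdeleRing (𝓞 L) L)))) (hU₀c : IsCompact (U₀ : Set (GL (Fin 3) (FiniteAdeleRing (𝓞 L) L))))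
  (hU₀K : U₀ ≤ glFiniteIntegralLevel 3 L)
  (hVU : ∀ φ ∈ V, ∀ b : finAdelic (↥(maximalRealSubfield L)) L (IsCMField.complexConj L) 3 ((StdForm.antidiagonal 3).over L), (b : GL (Fin 3) (FiniteAdeleRing (𝓞 L) L)) ∈ U₀ →
    ∀ y : (quasiSplit (↥(maximalRealSubfield L)) L (IsCMField.complexConj L) 3).Adelic, φ (y * finAdelicToAdelic (↥(maximalRealSubfield L)) L (IsCMField.complexConj L) 3 ((StdForm.antidiagonal 3).over L) b) = φ y)
  -- the PURE-TYPE LETTERS (★ scalar port's binders): a `K_∞`-type `(W, τ)`, the archimedean left law `cB z` of the flat sections of `V` along `B_∞`, the `W`-isotypy of `V`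
  {W : Type*} [AddCommGroup W] [Module ℂ W] (τ : arch (↥(maximalRealSubfield L)) L (IsCMField.complexConj L) 3 ((StdForm.antidiagonal 3).over L) → W →ₗ[ℂ] W)
  (cB : ℂ → arch (↥(maximalRealSubfield L)) L (IsCMField.complexConj L) 3 ((StdForm.antidiagonal 3).over L) → ℂ)
  (hVB : ∀ (z : ℂ), ∀ φ ∈ V, ∀ b ∈ (borelAdelic (↥(maximalRealSubfield L)) L (IsCMField.complexConj L) 3).comap (archToAdelic (↥(maximalRealSubfield L)) L (IsCMField.complexConj L) 3 ((StdForm.antidiagonal 3).over L)),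
    ∀ (a : arch (↥(maximalRealSubfield L)) L (IsCMField.complexConj L) 3 ((StdForm.antidiagonal 3).over L)) (xf : finAdelic (↥(maximalRealSubfield L)) L (IsCMField.complexConj L) 3 ((StdForm.antidiagonal 3).over L)),
      flatSectionU φ z (archToAdelic (↥(maximalRealSubfield L)) L (IsCMField.complexConj L) 3 _ (b * a) * finAdelicToAdelic (↥(maximalRealSubfield L)) L (IsCMField.complexConj L) 3 _ xf) =
        cB z b * flatSectionU φ z (archToAdelic (↥(maximalRealSubfield L)) L (IsCMField.complexConj L) 3 _ a * finAdelicToAdelic (↥(maximalRealSubfield L)) L (IsCMField.complexConj L) 3 _ xf))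
  (hVτ : V ≤ ⨆ (J : W →ₗ[ℂ] ((quasiSplit (↥(maximalRealSubfield L)) L (IsCMField.complexConj L) 3).Adelic → ℂ)) (_ : LinearMap.range J ≤ V ∧
    ∀ k ∈ (((standardMaximalCompactGL 3 L).comap (adelicVal (↥(maximalRealSubfield L)) L (IsCMField.complexConj L) 3 ((StdForm.antidiagonal 3).over L))).comap
        (archToAdelic (↥(maximalRealSubfield L)) L (IsCMField.complexConj L) 3 ((StdForm.antidiagonal 3).over L))),
      ∀ (v : W) (x : (quasiSplit (↥(maximalRealSubfield L)) L (IsCMField.complexConj L) 3).Adelic), J v (x * archToAdelic (↥(maximalRealSubfield L)) L (IsCMField.complexConj L) 3 _ k) = J (τ k v) x), LinearMap.range J)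

include μ h𝓕N h𝓕c h𝓕₀ hβ hμZ μa μf hχ₂ hVK hVχ hVc hVM hU₀o hU₀c hU₀K hVU hVB hVτ in
/-- **§1 HEAD — THE `χ`-EISENSTEIN EXPORTS WITH BOUND AT A PURE-TYPE K-FINITE BLOCK, BOTH τ-PORTS PLUGGED IN**: ★ `chiEisenstein_meromorphic_exports_kfinite_cm_three_of_gauge_letters` with
`hfam := hfam_gauge_of_scalars_cm_three … h12dCτ`, `hnc := hnc_gauge_of_scalars_cm_three … h12dCτ` and `h12dCτ :=` ★ `exists_integral_pureTensor_mul_flatSectionU_eq_tau` partially applied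
(`U := U₀ ∩ G_f` as a set of `G(𝔸_f)`); remaining visible letter of the pure-type side: THE LINE `hline z` of the τ-embeddings `W → I_∞(cB z)` (★ `K2E1ChiHeckeArchScalarTauU2` §1).  Conclusion =
★ T head's, byte for byte: columns `φ'` (★ (b′)), scattering coordinates `q`, continued family `Ec`, continued coordinates `qc`, ONE closed co-discrete pole set `P ⊆ {Re ≤ 2}` with (E1)–(E4), (E2-bd).
[cite: BernsteinLapid2019, Thm 2.3, §4 Claim 1, §7] [cite: MoeglinWaldspurger1995, II.1.7, IV.1.8–IV.1.11] [cite: Knapp1986, VII §1–§2] [cite: Bump1997, proof of Lemma 2.3.2] -/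
theorem chiEisenstein_meromorphic_exports_kfinite_of_ports
    (hline : ∀ z : ℂ, ∃ j₀ : W →ₗ[ℂ] (arch (↥(maximalRealSubfield L)) L (IsCMField.complexConj L) 3 ((StdForm.antidiagonal 3).over L) → ℂ),
      ∀ j : W →ₗ[ℂ] (arch (↥(maximalRealSubfield L)) L (IsCMField.complexConj L) 3 ((StdForm.antidiagonal 3).over L) → ℂ),
        (∀ w, ∀ b ∈ (borelAdelic (↥(maximalRealSubfield L)) L (IsCMField.complexConj L) 3).comap (archToAdelic (↥(maximalRealSubfield L)) L (IsCMField.complexConj L) 3 ((StdForm.antidiagonal 3).over L)),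
          ∀ g, j w (b * g) = cB z b * j w g) →
        (∀ k ∈ (((standardMaximalCompactGL 3 L).comap (adelicVal (↥(maximalRealSubfield L)) L (IsCMField.complexConj L) 3 ((StdForm.antidiagonal 3).over L))).comap
            (archToAdelic (↥(maximalRealSubfield L)) L (IsCMField.complexConj L) 3 ((StdForm.antidiagonal 3).over L))),
          ∀ (w : W) (g : arch (↥(maximalRealSubfield L)) L (IsCMField.complexConj L) 3 ((StdForm.antidiagonal 3).over L)), j w (g * k) = j (τ k w) g) → ∃ a : ℂ, j = a • j₀)
    {φ : (quasiSplit (↥(maximalRealSubfield L)) L (IsCMField.complexConj L) 3).Adelic → ℂ} (hφ : φ ∈ V) :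
    ∃ (n : ℕ) (φ' : Fin n → (quasiSplit (↥(maximalRealSubfield L)) L (IsCMField.complexConj L) 3).Adelic → ℂ) (q : Fin n → ℂ → ℂ) (Ec : ℂ → (quasiSplit (↥(maximalRealSubfield L)) L (IsCMField.complexConj L) 3).Adelic → ℂ) (qc : Fin n → ℂ → ℂ) (P : Set ℂ),
      -- the columns (★ (b′)) and the scattering coordinates (★ 7c)
      LinearIndependent ℂ φ' ∧ (∀ j, IsChiSectionPair (reflectChar (IsCMField.complexConj L) χ₁) χ₂ (φ' j)) ∧ (∀ j, Continuous (φ' j)) ∧ (∃ Mb : ℝ, ∀ j x, ‖φ' j x‖ ≤ Mb) ∧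
      (∀ j, DifferentiableOn ℂ (q j) {z : ℂ | 2 < z.re}) ∧
      (∀ z : ℂ, 2 < z.re → (∑ j, q j z • φ' j) = ((((ν 𝓕).toReal⁻¹ : ℝ)) : ℂ) • (fun g : (quasiSplit (↥(maximalRealSubfield L)) L (IsCMField.complexConj L) 3).Adelic => (∫ v : ↥(adelicUnipotent (↥(maximalRealSubfield L)) L (IsCMField.complexConj L) 3), flatSectionU φ z ((quasiSplit (↥(maximalRealSubfield L)) L (IsCMField.complexConj L) 3).toAdelic (weylLongU ((IsCMField.complexConj L : L ≃ₐ[↥(maximalRealSubfield L)] L) : L →+* L) (rfl : (StdForm.antidiagonal 3).over L = (StdForm.antidiagonal 3).over L)) * ((v : (quasiSplit (↥(maximalRealSubfield L)) L (IsCMField.complexConj L) 3).Adelic) * g)) ∂ν) * (((borelHeight g : ℝ) : ℂ) ^ (z - 2)))) ∧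
      -- ★ with-bound's clause list: (E1) normal forms, tube identity, `qc = q` on `{2 < Re}`, the pole set, analyticity ∕ holomorphy off `P`, (E4), (E2-bd)
      ((∀ g, MeromorphicNFOn (fun z => Ec z g) univ) ∧ (∀ j, MeromorphicNFOn (qc j) univ) ∧
      (∀ z : ℂ, 2 < z.re → Ec z = eisensteinSeriesU (flatSectionU φ z)) ∧ (∀ j (z : ℂ), 2 < z.re → qc j z = q j z) ∧
      IsClosed P ∧ (∀ z₀ : ℂ, ∀ᶠ s in 𝓝[≠] z₀, s ∉ P) ∧ (∀ z ∈ P, z.re ≤ 2) ∧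
      (∀ g (z : ℂ), z ∉ P → AnalyticAt ℂ (fun z => Ec z g) z) ∧ (∀ j (z : ℂ), z ∉ P → AnalyticAt ℂ (qc j) z) ∧
      (∀ g, DifferentiableOn ℂ (fun z => Ec z g) Pᶜ) ∧ (∀ j, DifferentiableOn ℂ (qc j) Pᶜ) ∧
      (∀ z : ℂ, z ∉ P → Continuous (Ec z)) ∧
      -- (E2-bd) THE JOINT LOCAL BOUND off `P`
      (∀ z₁ : ℂ, z₁ ∉ P → ∀ K : Set (quasiSplit (↥(maximalRealSubfield L)) L (IsCMField.complexConj L) 3).Adelic, IsCompact K → ∃ V ∈ 𝓝 z₁, ∃ M : ℝ, ∀ z ∈ V, ∀ g ∈ K, ‖Ec z g‖ ≤ M)) := by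
  -- «vanishing on `K_max` ⇒ `0`» for the members of `V` (pair-sections, CM Iwasawa)
  have hVK₀ : ∀ ψ ∈ V, (∀ k : (quasiSplit (↥(maximalRealSubfield L)) L (IsCMField.complexConj L) 3).Adelic,
      adelicVal (↥(maximalRealSubfield L)) L (IsCMField.complexConj L) 3 ((StdForm.antidiagonal 3).over L) k ∈ standardMaximalCompactGL 3 L → ψ k = 0) → ψ = 0 :=
    fun ψ hψ h0 => eq_zero_of_forall_K_eq_zero_of_isChiSectionPair_cm L (hVχ ψ hψ) h0
  -- the level `U := U₀ ∩ G_f` as a set of `G(𝔸_f)`: inside `K`, and `V` is right-invariant under it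
  have hUK : ∀ b ∈ ((U₀.subgroupOf (finAdelic (↥(maximalRealSubfield L)) L (IsCMField.complexConj L) 3 ((StdForm.antidiagonal 3).over L)) : Subgroup _) :
      Set (finAdelic (↥(maximalRealSubfield L)) L (IsCMField.complexConj L) 3 ((StdForm.antidiagonal 3).over L))),
      adelicVal (↥(maximalRealSubfield L)) L (IsCMField.complexConj L) 3 ((StdForm.antidiagonal 3).over L)
        (finAdelicToAdelic (↥(maximalRealSubfield L)) L (IsCMField.complexConj L) 3 _ b) ∈ standardMaximalCompactGL 3 L :=
    fun b hb => adelicVal_finAdelicToAdelic_mem_of_mem_glFiniteIntegralLevel (hU₀K (Subgroup.mem_subgroupOf.1 hb))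
  have hVU' : ∀ ψ ∈ V, ∀ b ∈ ((U₀.subgroupOf (finAdelic (↥(maximalRealSubfield L)) L (IsCMField.complexConj L) 3 ((StdForm.antidiagonal 3).over L)) : Subgroup _) :
      Set (finAdelic (↥(maximalRealSubfield L)) L (IsCMField.complexConj L) 3 ((StdForm.antidiagonal 3).over L))),
      ∀ x : (quasiSplit (↥(maximalRealSubfield L)) L (IsCMField.complexConj L) 3).Adelic, ψ (x * finAdelicToAdelic (↥(maximalRealSubfield L)) L (IsCMField.complexConj L) 3 _ b) = ψ x :=
    fun ψ hψ b hb x => hVU ψ hψ b (Subgroup.mem_subgroupOf.1 hb) x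
  exact chiEisenstein_meromorphic_exports_kfinite_cm_three_of_gauge_letters L μ νG ν h𝓕N h𝓕c h𝓕₀ hβ hμZ hχ₂ V hVK hVχ hVc hVM
    (hfam_gauge_of_scalars_cm_three L νG μa μf U₀ hU₀o hU₀c hU₀K V hVc hVU hVK₀ fun h hinf hh hhs hten hcent z =>
      exists_integral_pureTensor_mul_flatSectionU_eq_tau νG μa μf V hVc hUK hVU' τ cB hVB hVτ hline hh hhs hten hcent z)
    (hnc_gauge_of_scalars_cm_three L νG μa μf U₀ hU₀o hU₀c hU₀K V hVc hVU hVK₀ fun h hinf hh hhs hten hcent z =>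
      exists_integral_pureTensor_mul_flatSectionU_eq_tau νG μa μf V hVc hUK hVU' τ cB hVB hVτ hline hh hhs hten hcent z)
    hφ

include μ h𝓕N h𝓕c h𝓕₀ hβ hμZ μa μf hχ₂ hVK hVχ hVc hVM hU₀o hU₀c hU₀K hVU hVB hVτ in
/-- **§2 HEAD — THE SAME FROM THE `z`-FREE CO-WEIGHT LINE**: as `chiEisenstein_meromorphic_exports_kfinite_of_ports`, with THE LINE replaced by a function `χM` on `G_∞` agreeing with every `cB z` on
`M_∞ = B_∞ ∩ K_∞` (`hcBM`) and the CO-WEIGHT LINE «the linear `λ : W → ℂ` with `λ(τ(m)w) = χM(m)λ(w)` on `M_∞` form a line» (`hco`; the Frobenius image of ★ `R90S8KTypeSliceLineU3`'s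
multiplicity-one line) — ★ `exists_line_of_coweightLine` with the CM arch Iwasawa (`c ≠ 1`: ★ `IsCMField.complexConj_ne_one`; ★ `complexConj_smul_infinitePlace`).
[cite: Knapp1986, VII §1–§2] [cite: BernsteinLapid2019, Thm 2.3, §4 Claim 1] [cite: MoeglinWaldspurger1995, II.1.7, IV.1.8–IV.1.11] -/
theorem chiEisenstein_meromorphic_exports_kfinite_of_ports_of_coweightLine
    (χM : arch (↥(maximalRealSubfield L)) L (IsCMField.complexConj L) 3 ((StdForm.antidiagonal 3).over L) → ℂ)
    (hcBM : ∀ (z : ℂ), ∀ m ∈ (borelAdelic (↥(maximalRealSubfield L)) L (IsCMField.complexConj L) 3).comap (archToAdelic (↥(maximalRealSubfield L)) L (IsCMField.complexConj L) 3 ((StdForm.antidiagonal 3).over L)),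
      m ∈ (((standardMaximalCompactGL 3 L).comap (adelicVal (↥(maximalRealSubfield L)) L (IsCMField.complexConj L) 3 ((StdForm.antidiagonal 3).over L))).comap
        (archToAdelic (↥(maximalRealSubfield L)) L (IsCMField.complexConj L) 3 ((StdForm.antidiagonal 3).over L))) → cB z m = χM m)
    (hco : ∃ l₀ : W →ₗ[ℂ] ℂ, ∀ l : W →ₗ[ℂ] ℂ,
      (∀ m ∈ (borelAdelic (↥(maximalRealSubfield L)) L (IsCMField.complexConj L) 3).comap (archToAdelic (↥(maximalRealSubfield L)) L (IsCMField.complexConj L) 3 ((StdForm.antidiagonal 3).over L)),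
        m ∈ (((standardMaximalCompactGL 3 L).comap (adelicVal (↥(maximalRealSubfield L)) L (IsCMField.complexConj L) 3 ((StdForm.antidiagonal 3).over L))).comap
          (archToAdelic (↥(maximalRealSubfield L)) L (IsCMField.complexConj L) 3 ((StdForm.antidiagonal 3).over L))) → ∀ w, l (τ m w) = χM m * l w) → ∃ a : ℂ, l = a • l₀)
    {φ : (quasiSplit (↥(maximalRealSubfield L)) L (IsCMField.complexConj L) 3).Adelic → ℂ} (hφ : φ ∈ V) :
    ∃ (n : ℕ) (φ' : Fin n → (quasiSplit (↥(maximalRealSubfield L)) L (IsCMField.complexConj L) 3).Adelic → ℂ) (q : Fin n → ℂ → ℂ) (Ec : ℂ → (quasiSplit (↥(maximalRealSubfield L)) L (IsCMField.complexConj L) 3).Adelic → ℂ) (qc : Fin n → ℂ → ℂ) (P : Set ℂ),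
      LinearIndependent ℂ φ' ∧ (∀ j, IsChiSectionPair (reflectChar (IsCMField.complexConj L) χ₁) χ₂ (φ' j)) ∧ (∀ j, Continuous (φ' j)) ∧ (∃ Mb : ℝ, ∀ j x, ‖φ' j x‖ ≤ Mb) ∧
      (∀ j, DifferentiableOn ℂ (q j) {z : ℂ | 2 < z.re}) ∧
      (∀ z : ℂ, 2 < z.re → (∑ j, q j z • φ' j) = ((((ν 𝓕).toReal⁻¹ : ℝ)) : ℂ) • (fun g : (quasiSplit (↥(maximalRealSubfield L)) L (IsCMField.complexConj L) 3).Adelic => (∫ v : ↥(adelicUnipotent (↥(maximalRealSubfield L)) L (IsCMField.complexConj L) 3), flatSectionU φ z ((quasiSplit (↥(maximalRealSubfield L)) L (IsCMField.complexConj L) 3).toAdelic (weylLongU ((IsCMField.complexConj L : L ≃ₐ[↥(maximalRealSubfield L)] L) : L →+* L) (rfl : (StdForm.antidiagonal 3).over L = (StdForm.antidiagonal 3).over L)) * ((v : (quasiSplit (↥(maximalRealSubfield L)) L (IsCMField.complexConj L) 3).Adelic) * g)) ∂ν) * (((borelHeight g : ℝ) : ℂ) ^ (z - 2)))) ∧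
      ((∀ g, MeromorphicNFOn (fun z => Ec z g) univ) ∧ (∀ j, MeromorphicNFOn (qc j) univ) ∧
      (∀ z : ℂ, 2 < z.re → Ec z = eisensteinSeriesU (flatSectionU φ z)) ∧ (∀ j (z : ℂ), 2 < z.re → qc j z = q j z) ∧
      IsClosed P ∧ (∀ z₀ : ℂ, ∀ᶠ s in 𝓝[≠] z₀, s ∉ P) ∧ (∀ z ∈ P, z.re ≤ 2) ∧
      (∀ g (z : ℂ), z ∉ P → AnalyticAt ℂ (fun z => Ec z g) z) ∧ (∀ j (z : ℂ), z ∉ P → AnalyticAt ℂ (qc j) z) ∧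
      (∀ g, DifferentiableOn ℂ (fun z => Ec z g) Pᶜ) ∧ (∀ j, DifferentiableOn ℂ (qc j) Pᶜ) ∧
      (∀ z : ℂ, z ∉ P → Continuous (Ec z)) ∧
      (∀ z₁ : ℂ, z₁ ∉ P → ∀ K : Set (quasiSplit (↥(maximalRealSubfield L)) L (IsCMField.complexConj L) 3).Adelic, IsCompact K → ∃ V ∈ 𝓝 z₁, ∃ M : ℝ, ∀ z ∈ V, ∀ g ∈ K, ‖Ec z g‖ ≤ M)) := by
  refine chiEisenstein_meromorphic_exports_kfinite_of_ports L μ νG ν h𝓕N h𝓕c h𝓕₀ hβ hμZ μa μf hχ₂ V hVK hVχ hVc hVM U₀ hU₀o hU₀c hU₀K hVU τ cB hVB hVτ (fun z => ?_) hφ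
  obtain ⟨l₀, hl₀⟩ := hco
  exact exists_line_of_coweightLine _ _ (cB z) τ
    (K2E1ChiHeckeArchScalarU2.exists_mem_comap_borel_mul_mem_comap_K_arch (IsCMField.complexConj_ne_one L) (complexConj_smul_infinitePlace L))
    ⟨l₀, fun l hl => hl₀ l fun m hmB hmK w => by rw [← hcBM z m hmB hmK]; exact hl m hmB hmK w⟩

end Summit.HodgeConjecture.HodgeConjecture.Cruxes.H413.K2E1ChiEisensteinMeromorphicExportsKFiniteOfPortsCMThree

end
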